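import Summits.NavierStokesRegularity.NavierStokesRegularity.Theorems.ExtremalTypeIConstantSmallConstantLiouville
import Literature.Analysis.FluidPDE.TypeIAncientMild
import Literature.Analysis.FluidPDE.OseenDuhamelPairCalculus
import Literature.Analysis.FluidPDE.MildSolutionProofs
import HarnessLib

/-!
# Tools for the Type-I ancient mild class: eventual smallness ⇒ vanishing, and forward uniqueness
(extracted from LINE «screw-blowdown» v1.7, ns-idea-4 g12, for the census lead / typer; Theorems-ready, general `E`)

* `isTypeIAncientMild_of_decay` — re-constant a class member by a better temporal bound;
* `eq_zero_of_eventuallySmall` — if `‖u(τ,·)‖∞ ≤ A/√(−τ)` for `τ < T < 0` with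
  `A < 1/(8·oseenSliceConst E)`, then `u ≡ 0` on `(−∞, T)` (the tree's small-constant Liouville
  `smallConstantLiouville_eq_zero`, KNSS 2009 §4, transported by the time-translation invariance
  `IsTypeIAncientMild.comp_sub_right`);
* `eq_zero_of_vanishing_past` — FORWARD UNIQUENESS inside the class: `u ≡ 0` on `(−∞,T)`
  implies `u ≡ 0` on `(−∞,0)` (restart the mild identity at the last zero slice; block-halving with the slice
  bound `norm_oseenDuhamel_le_const`).
No summit / crux / row of record is proved here; these are class-general lemmas.
-/

namespace Summit.NavierStokesRegularity.NavierStokesRegularity.Theorems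

open MeasureTheory Set Function Filter Topology
open Literature.Analysis Literature.Analysis.FluidPDE

-- the summit namespace `…NavierStokesRegularity.NavierStokesRegularity…` is the tree convention (D-0017)
set_option linter.dupNamespace false

variable {E : Type*} [NormedAddCommGroup E] [InnerProductSpace ℝ E] [FiniteDimensional ℝ E]
  [MeasurableSpace E] [BorelSpace E]

/-- Re-constant a class member by a better temporal bound (the class predicate's last conjunct). -/
theorem isTypeIAncientMild_of_decay {C A : ℝ} {u : ℝ → E → E} (h : IsTypeIAncientMild C u)
    (hA : ∀ t < (0 : ℝ), ∀ x, ‖u t x‖ ≤ A / Real.sqrt (-t)) : IsTypeIAncientMild A u :=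
  ⟨h.1, h.2.1, h.2.2.1, hA⟩

/-- **(i) Eventual smallness ⇒ vanishing in the far past** (tree small-constant Liouville, KNSS 2009 §4, transported
to `(−∞, T)` by time translation). [cite: KochNadirashviliSereginSverak2009, §4 p. 8 (arXiv:0709.3599)] -/
theorem eq_zero_of_eventuallySmall {C : ℝ} {u : ℝ → E → E} (h : IsTypeIAncientMild C u) {T : ℝ} (hT : T < 0)
    {A : ℝ} (hA : A < 1 / (8 * oseenSliceConst E)) (hsmall : ∀ τ < T, ∀ y, ‖u τ y‖ ≤ A / Real.sqrt (-τ)) :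
    ∀ τ < T, ∀ y, u τ y = 0 := by
  have hA0 : 0 ≤ A := by
    have hs : 0 < Real.sqrt (-(T - 1)) := Real.sqrt_pos.2 (by linarith)
    have h0 := (norm_nonneg _).trans (hsmall (T - 1) (by linarith) 0)
    rw [le_div_iff₀ hs] at h0
    nlinarith
  set δ : ℝ := -T with hδ
  have hδ0 : 0 ≤ δ := by rw [hδ]; linarith
  have hv : IsTypeIAncientMild C (fun t => u (t - δ)) := h.comp_sub_right hδ0
  have hvA : ∀ t < (0 : ℝ), ∀ x, ‖(fun t => u (t - δ)) t x‖ ≤ A / Real.sqrt (-t) := by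
    intro t ht x
    have h1 := hsmall (t - δ) (by rw [hδ]; linarith) x
    refine h1.trans ?_
    exact div_le_div_of_nonneg_left hA0 (Real.sqrt_pos.2 (by linarith)) (Real.sqrt_le_sqrt (by linarith))
  have hvA' : IsTypeIAncientMild A (fun t => u (t - δ)) := isTypeIAncientMild_of_decay hv hvA
  intro τ hτ y
  have h0 := smallConstantLiouville_eq_zero hvA' hA (t := τ + δ) (by rw [hδ]; linarith) y
  simpa using h0

/-- **(ii) Forward uniqueness in the class**: a field of the class vanishing for all `t < T` vanishes for all `t < 0`
(the mild identity restarted at the last zero slice; block-halving with the slice bound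
`‖B_α(u,u)(σ)‖ ≤ C₀ · M M′ · 2√(σ−α)`, KNSS 2009 §3–§4). [cite: KochNadirashviliSereginSverak2009, §4 p. 8 (arXiv:0709.3599)] -/
theorem eq_zero_of_vanishing_past {C : ℝ} {u : ℝ → E → E} (h : IsTypeIAncientMild C u) {T : ℝ}
    (hz : ∀ t < T, ∀ x, u t x = 0) : ∀ t < (0 : ℝ), ∀ x, u t x = 0 := by
  intro t₀ ht₀
  by_cases hlt : t₀ < T
  · exact hz t₀ hlt
  push Not at hlt
  -- uniform bound `M` on `τ ≤ t₀`
  set M : ℝ := C / Real.sqrt (-t₀) with hM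
  have hCnn : 0 ≤ C := h.nonneg
  have hst0 : 0 < Real.sqrt (-t₀) := Real.sqrt_pos.2 (by linarith)
  have hM0 : 0 ≤ M := by rw [hM]; positivity
  have hbound : ∀ τ ≤ t₀, ∀ y, ‖u τ y‖ ≤ M := by
    intro τ hτ y
    refine (h.norm_le (by linarith) y).trans ?_
    rw [hM]
    exact div_le_div_of_nonneg_left hCnn hst0 (Real.sqrt_le_sqrt (by linarith))
  have hC₀ : 0 < oseenSliceConst E := oseenSliceConst_pos
  -- block length
  set η : ℝ := 1 / (16 * oseenSliceConst E ^ 2 * M ^ 2 + 1) with hη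
  have hη0 : 0 < η := by rw [hη]; positivity
  have hq : oseenSliceConst E * M * (2 * Real.sqrt η) ≤ 1 / 2 := by
    have h1 : 16 * oseenSliceConst E ^ 2 * M ^ 2 * η ≤ 1 := by
      have : η * (16 * oseenSliceConst E ^ 2 * M ^ 2 + 1) = 1 := by
        rw [hη]; field_simp
      nlinarith
    have h2 : (oseenSliceConst E * M * (2 * Real.sqrt η)) ^ 2 ≤ (1 / 2) ^ 2 := by
      rw [mul_pow, mul_pow, mul_pow, Real.sq_sqrt hη0.le]
      nlinarith
    have h3 : 0 ≤ oseenSliceConst E * M * (2 * Real.sqrt η) := by positivity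
    nlinarith [h2, h3]
  -- one block
  have hblock : ∀ α : ℝ, (∀ τ ≤ α, τ ≤ t₀ → ∀ y, u τ y = 0) → ∀ τ ≤ α + η, τ ≤ t₀ → ∀ y, u τ y = 0 := by
    intro α hα τ hτ hτ0 y
    by_cases hτα : τ ≤ α
    · exact hα τ hτα hτ0 y
    push Not at hτα
    have hα0 : α ≤ t₀ := hτα.le.trans hτ0
    -- the distance to zero halves indefinitely on the block
    have hiter : ∀ n : ℕ, ∀ σ, α < σ → σ ≤ α + η → σ ≤ t₀ → ∀ z, ‖u σ z‖ ≤ M / 2 ^ n := by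
      intro n
      induction n with
      | zero =>
        intro σ _ _ hσ0 z
        simpa using hbound σ hσ0 z
      | succ n ih =>
        intro σ hσ1 hσ2 hσ0 z
        have hσneg : σ < 0 := by linarith
        have hzero : ∀ w, u α w = 0 := fun w => hα α le_rfl hα0 w
        have hheat : heatFlow (u α) (σ - α) z = 0 := by
          have h0 : ‖heatFlow (u α) (σ - α) z‖ ≤ 0 :=
            norm_heatFlow_le (fun w => by rw [hzero w, norm_zero]) (σ - α) z
          exact norm_le_zero_iff.1 h0
        have ha : ∀ τ' ∈ Ioo α σ, ∀ w, ‖u τ' w‖ ≤ M / 2 ^ n :=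
          fun τ' hτ' w => ih τ' hτ'.1 (by linarith [hτ'.2]) (by linarith [hτ'.2]) w
        have hb : ∀ τ' ∈ Ioo α σ, ∀ w, ‖u τ' w‖ ≤ M := fun τ' hτ' w => hbound τ' (by linarith [hτ'.2]) w
        have hduh := norm_oseenDuhamel_le_const hσ1.le ha hb z
        have hsq : Real.sqrt (σ - α) ≤ Real.sqrt η := Real.sqrt_le_sqrt (by linarith)
        have hMn : 0 ≤ M / 2 ^ n := by positivity
        calc ‖u σ z‖ = ‖heatFlow (u α) (σ - α) z - oseenDuhamel 1 α u u σ z‖ := by rw [← h.mild_eq hσ1 hσneg z]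
          _ = ‖oseenDuhamel 1 α u u σ z‖ := by rw [hheat, zero_sub, norm_neg]
          _ ≤ oseenSliceConst E * (M / 2 ^ n * M) * (2 * Real.sqrt (σ - α)) := hduh
          _ ≤ oseenSliceConst E * (M / 2 ^ n * M) * (2 * Real.sqrt η) := by gcongr
          _ = M / 2 ^ n * (oseenSliceConst E * M * (2 * Real.sqrt η)) := by ring
          _ ≤ M / 2 ^ n * (1 / 2) := mul_le_mul_of_nonneg_left hq hMn
          _ = M / 2 ^ (n + 1) := by rw [pow_succ]; ring
    have hlim : Tendsto (fun n : ℕ => M / 2 ^ n) atTop (𝓝 0) := by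
      have h1 : Tendsto (fun n : ℕ => M * (1 / 2) ^ n) atTop (𝓝 (M * 0)) :=
        (tendsto_pow_atTop_nhds_zero_of_lt_one (by norm_num) (by norm_num)).const_mul M
      rw [mul_zero] at h1
      refine h1.congr fun n => ?_
      rw [one_div, inv_pow, div_eq_mul_inv]
    have hle : ‖u τ y‖ ≤ 0 := ge_of_tendsto' hlim fun n => hiter n τ hτα hτ hτ0 y
    exact norm_le_zero_iff.1 hle
  -- induction over blocks starting from `T - 1`
  have hind : ∀ k : ℕ, ∀ τ ≤ T - 1 + k * η, τ ≤ t₀ → ∀ y, u τ y = 0 := by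
    intro k
    induction k with
    | zero =>
      intro τ hτ _ y
      exact hz τ (by simp at hτ; linarith) y
    | succ k ih =>
      intro τ hτ hτ0 y
      refine hblock (T - 1 + k * η) ih τ ?_ hτ0 y
      push_cast at hτ
      linarith
  obtain ⟨k, hk⟩ : ∃ k : ℕ, t₀ ≤ T - 1 + k * η := by
    obtain ⟨k, hk⟩ := exists_nat_ge ((t₀ - T + 1) / η)
    refine ⟨k, ?_⟩
    have := (div_le_iff₀ hη0).1 hk
    linarith
  intro x
  exact hind k t₀ hk le_rfl x


end Summit.NavierStokesRegularity.NavierStokesRegularity.Theorems
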